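import Mathlib
import Literature.NumberTheory.LFunctions.VanDerCorputZeta
import Literature.NumberTheory.LFunctions.CoprimeResidueSums
import HarnessLib

/-!
# Crux `DigitPolyUniformity` (stmt-QuantumAdvantage-1392), line `Sketch` (LAR composition):
# finite Fourier expansion in the low binary digits

Stub `stub_fourier_lowDigits` (seat c5, wave 5, the Matomäki–Radziwiłł–Tao classes). A phase that
depends only on the `C` lowest binary digits of `N` is a function of `N mod 2^C`; every `1`-bounded
such function `g` is a combination of the `2^C` additive characters `N ↦ e(aN/2^C)` with `1`-bounded
coefficients `c_a = 2^{-C} Σ_{r<2^C} g(r) e(-ar/2^C)` (orthogonality of the characters of `ℤ/2^C`,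
i.e. the complete exponential sum `Σ_{a<q} e(ak/q) = q·[q ∣ k]`,
`Literature.NumberTheory.LFunctions.CoprimeResidueSums.sum_range_exp_eq`). Each piece is then a
linear phase `e(αN)` with `α = a/2^C`, to which the tree's Matomäki–Radziwiłł–Tao Theorem 1.3
applies termwise (lead's composition, file `Theorems/…MRTClasses`). The statement is proved for an
arbitrary modulus `q > 0` (`FourierLowDigits.fourier_mod`) and specialised to `q = 2^C`.
-/

noncomputable section

namespace Summit.QuantumAdvantage.DigitPolyUniformity.SketchLAR

open Finset
open Literature.NumberTheory.LFunctions (VdC.e VdC.e_add VdC.norm_e)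

namespace FourierLowDigits

/-- The tree's `e(x) = exp(2πix)` at `x = ak/q` in the `Complex.exp (2π I k a / q)` normal form of
`CoprimeResidueSums.sum_range_exp_eq`. [folklore] -/
theorem e_eq_exp (a q : ℕ) (k : ℤ) :
    VdC.e ((a : ℝ) * k / q) = Complex.exp (2 * Real.pi * Complex.I * k * a / q) := by
  simp only [VdC.e]
  congr 1
  push_cast
  ring

/-- **Orthogonality of the additive characters mod `q`.** For `0 < q` and `k ∈ ℤ`,
`Σ_{a<q} e(ak/q) = q` if `q ∣ k` and `= 0` otherwise. [folklore] -/
theorem sum_range_e_eq (q : ℕ) (hq : 0 < q) (k : ℤ) :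
    ∑ a ∈ range q, VdC.e ((a : ℝ) * k / q) = if (q : ℤ) ∣ k then (q : ℂ) else 0 := by
  rw [← Literature.NumberTheory.LFunctions.CoprimeResidueSums.sum_range_exp_eq q hq k]
  exact Finset.sum_congr rfl fun a _ => e_eq_exp a q k

/-- For a residue `r < q`: `q ∣ N − r` (in `ℤ`) iff `r = N mod q`. [folklore] -/
theorem dvd_sub_iff {q N r : ℕ} (hr : r < q) : (q : ℤ) ∣ ((N : ℤ) - r) ↔ r = N % q := by
  rw [← Nat.modEq_iff_dvd, Nat.ModEq, Nat.mod_eq_of_lt hr]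

/-- Combining exponents: `e(−ar/q) e(aN/q) = e(a(N − r)/q)`. [folklore] -/
theorem e_neg_mul_e (a r N q : ℕ) :
    VdC.e (-((a : ℝ) * r / q)) * VdC.e ((a : ℝ) * N / q) =
      VdC.e ((a : ℝ) * (((N : ℤ) - r : ℤ) : ℝ) / q) := by
  rw [← VdC.e_add]
  congr 1
  push_cast
  ring

/-- **Finite Fourier expansion on `ℤ/q`.** For `0 < q`, every `1`-bounded `g` satisfies
`g (N mod q) = Σ_{a<q} c_a e(aN/q)` for all `N`, with the `1`-bounded coefficients
`c_a = q⁻¹ Σ_{r<q} g(r) e(−ar/q)`. [folklore] -/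
theorem fourier_mod (q : ℕ) (hq : 0 < q) (g : ℕ → ℂ) (hg : ∀ r, ‖g r‖ ≤ 1) :
    ∃ c : ℕ → ℂ, (∀ a, ‖c a‖ ≤ 1) ∧
      ∀ N : ℕ, g (N % q) = ∑ a ∈ range q, c a * VdC.e ((a : ℝ) * N / q) := by
  have hqC : (q : ℂ) ≠ 0 := by exact_mod_cast hq.ne'
  have hqR : (0 : ℝ) < q := by exact_mod_cast hq
  refine ⟨fun a => (q : ℂ)⁻¹ * ∑ r ∈ range q, g r * VdC.e (-((a : ℝ) * r / q)),
    fun a => ?_, fun N => ?_⟩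
  · -- `‖c_a‖ ≤ q⁻¹ Σ_r ‖g r‖ ≤ 1`
    rw [norm_mul, norm_inv, Complex.norm_natCast]
    have hsum : ‖∑ r ∈ range q, g r * VdC.e (-((a : ℝ) * r / q))‖ ≤ q := by
      calc ‖∑ r ∈ range q, g r * VdC.e (-((a : ℝ) * r / q))‖
          ≤ ∑ r ∈ range q, ‖g r * VdC.e (-((a : ℝ) * r / q))‖ := norm_sum_le _ _
        _ ≤ ∑ _r ∈ range q, (1 : ℝ) := Finset.sum_le_sum fun r _ => by
            rw [norm_mul, VdC.norm_e, mul_one]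
            exact hg r
        _ = q := by simp
    calc (q : ℝ)⁻¹ * ‖∑ r ∈ range q, g r * VdC.e (-((a : ℝ) * r / q))‖
        ≤ (q : ℝ)⁻¹ * q := by gcongr
      _ = 1 := inv_mul_cancel₀ hqR.ne'
  · -- inversion: swap the sums and use orthogonality
    symm
    calc ∑ a ∈ range q, ((q : ℂ)⁻¹ * ∑ r ∈ range q, g r * VdC.e (-((a : ℝ) * r / q))) *
            VdC.e ((a : ℝ) * N / q)
        = ∑ a ∈ range q, ∑ r ∈ range q,
            (q : ℂ)⁻¹ * (g r * VdC.e ((a : ℝ) * (((N : ℤ) - r : ℤ) : ℝ) / q)) := by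
          refine Finset.sum_congr rfl fun a _ => ?_
          rw [Finset.mul_sum, Finset.sum_mul]
          refine Finset.sum_congr rfl fun r _ => ?_
          rw [← e_neg_mul_e]
          ring
      _ = (q : ℂ)⁻¹ * ∑ r ∈ range q,
            g r * ∑ a ∈ range q, VdC.e ((a : ℝ) * (((N : ℤ) - r : ℤ) : ℝ) / q) := by
          rw [Finset.sum_comm, Finset.mul_sum]
          refine Finset.sum_congr rfl fun r _ => ?_
          rw [Finset.mul_sum, Finset.mul_sum]
      _ = (q : ℂ)⁻¹ * ∑ r ∈ range q, (if r = N % q then g r * q else 0) := by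
          congr 1
          refine Finset.sum_congr rfl fun r hr => ?_
          rw [sum_range_e_eq q hq]
          by_cases h : r = N % q
          · rw [if_pos ((dvd_sub_iff (mem_range.1 hr)).2 h), if_pos h]
          · rw [if_neg (mt (dvd_sub_iff (mem_range.1 hr)).1 h), if_neg h, mul_zero]
      _ = g (N % q) := by
          rw [Finset.sum_ite_eq_of_mem' _ _ _ (mem_range.2 (Nat.mod_lt N hq))]
          field_simp

end FourierLowDigits

/-- **Stub (c5/S3): finite Fourier expansion in the low digits.** Every `1`-bounded `g` on the residues
mod `2^C` is a combination of the `2^C` additive characters `N ↦ e(aN/2^C)` with `1`-bounded coefficients: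
`g (N mod 2^C) = Σ_{a<2^C} c_a e(a N / 2^C)` for all `N` (`c_a = 2^{−C} Σ_r g(r) e(−ar/2^C)`, orthogonality of
characters). [folklore] -/
theorem stub_fourier_lowDigits (C : ℕ) (g : ℕ → ℂ) (hg : ∀ r, ‖g r‖ ≤ 1) :
    ∃ c : ℕ → ℂ, (∀ a, ‖c a‖ ≤ 1) ∧
      ∀ N : ℕ, g (N % 2 ^ C) = ∑ a ∈ range (2 ^ C), c a *
        Literature.NumberTheory.LFunctions.VdC.e ((a : ℝ) * N / 2 ^ C) := by
  obtain ⟨c, hc, h⟩ := FourierLowDigits.fourier_mod (2 ^ C) (by positivity) g hg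
  refine ⟨c, hc, fun N => ?_⟩
  have hN := h N
  push_cast at hN
  exact hN

end Summit.QuantumAdvantage.DigitPolyUniformity.SketchLAR

end
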